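import Summits.Ventures.PercRepro.Night2OneFatCaseOneAssemblyE

/-!
# PercRepro — THE CASE-1 COLUMN BOUND, general form: the sources lie among the coloops of a source's erasure (night-2, gen 29)

`sum_gtLoadAt_le_cap2_of_sources_triple`: the assembly `sum_gtLoadAt_le_cap2_of_one_coloop` (Night2OneFatCaseOneMain) with the
hypothesis `8 ≤ |S ∖ K|` replaced by what it is used for — every source `y ≠ y₁` of `S` is a coloop of `(S ∖ y₁) ∖ K` for every
source `y₁` (`hsrc`); the eight-point case (`mem_coloops_of_source'`) and the seven-point case with a unique collinear triple
derive `hsrc` (Night2OneFatCaseOneSeven).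
-/

namespace PercRepro.Shadow

open Finset PerFlat ThmH

variable {α : Type*} [DecidableEq α] {M : Matroid α} [M.Finite] {G : Finset α}

section MainB

set_option maxHeartbeats 1600000 in
open scoped Classical in
/-- **THE CASE-1 COLUMN BOUND (good-source load) AT A ONE-COLOOP TARGET WHOSE SOURCES LIE AMONG THE COLOOPS OF A SOURCE'S
ERASURE** (`hsrc`: for every source `y₁` of `S`, every other source `y` is a coloop of `(S ∖ y₁) ∖ K`). -/
theorem sum_gtLoadAt_le_cap2_of_sources_triple (hG : G ∈ flatsQ M (5 + 1)) (hd : (gr M \ G).card = 2)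
    (hk : kColoops M G = 1) (hs : ∀ e ∈ gr M, ∀ f ∈ gr M, e ≠ f → rkN M {e, f} = 2)
    (hl : ∀ e ∈ gr M, M.Indep {e}) (hfat : (fatClosures M 5 G 2).card ≤ 1) {S : Finset α} (hSG : S ⊆ G)
    (hKS : coloops M G ⊆ S) {w : α} (hc : coloops M (S \ coloops M G) = {w})
    (hsrc : ∀ y₁ ∈ S, (∃ w' ∈ S.erase y₁, faceLossP M 5 G (bigP M G) (S.erase y₁) w' ≠ 0) →
      ∀ y ∈ S, y ≠ y₁ → (∃ w' ∈ S.erase y, faceLossP M 5 G (bigP M G) (S.erase y) w' ≠ 0) →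
      y ∈ coloops M (S.erase y₁ \ coloops M G)) :
    ∑ y ∈ S, gtLoadAt M 5 G (bigP M G) (S.erase y) y ≤ cap2 M 5 G S := by
  have hd' : (gr M \ G).card ≤ 5 := by omega
  have hGg : G ⊆ gr M := (mem_flatsQ.1 hG).1
  have hc1 : (coloops M (S \ coloops M G)).card ≤ 1 := by rw [hc, Finset.card_singleton]
  have hcapS := capS_ge_eleven_eighteenths_two_one hd hk hSG
  have hcap2 := cap2_ge_capS_sub_L1_of_le hG hd' S
  have hL1S := L1_le_of_card_coloops_le_one hG hd hc1
  have hnn : ∀ y, 0 ≤ gtLoadAt M 5 G (bigP M G) (S.erase y) y := fun y => gtLoadAt_nonneg hG hd' _ _ y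
  -- no source: nothing to pay
  by_cases hsrc : ∃ y ∈ S, ∃ w' ∈ S.erase y, faceLossP M 5 G (bigP M G) (S.erase y) w' ≠ 0
  swap
  · push Not at hsrc
    have h0 : ∑ y ∈ S, gtLoadAt M 5 G (bigP M G) (S.erase y) y = 0 :=
      Finset.sum_eq_zero (fun y hy => gtLoadAt_eq_zero_of_faceLossP_eq_zero _ (fun w' hw' => hsrc y hy w' hw') y)
    rw [h0]; linarith
  obtain ⟨y₁, hy₁S, w₁, hw₁, h0₁⟩ := hsrc
  -- the structure of the source `y₁`
  obtain ⟨hQ₁G, hQ₁5, hC₁3, hImg₁, hR₁, hR₁3⟩ := lossy_structure_of_faceLossP_ne_zero hG hd hk hs hl hw₁ h0₁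
  have hwc : w ∈ coloops M (S \ coloops M G) := by rw [hc]; exact Finset.mem_singleton_self _
  have hy₁w : y₁ ≠ w := fun h =>
    h0₁ (by rw [h]; exact faceLossP_eq_zero_of_mem_coloops hG hd hk hs hl hSG hwc (h ▸ hw₁))
  have hy₁K : y₁ ∉ coloops M G := by
    intro hK
    obtain ⟨hthin, -, -, -⟩ := faceLossP_structure h0₁
    exact (Finset.notMem_erase y₁ S) ((Finset.erase_subset _ _) (coloops_subset_of_mem_thinMembers hG hd' hthin hK))
  have hy₁V : y₁ ∈ S \ coloops M G := Finset.mem_sdiff.2 ⟨hy₁S, hy₁K⟩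
  have hy₁c : y₁ ∉ coloops M (S \ coloops M G) := by rw [hc, Finset.mem_singleton]; exact hy₁w
  have hVg : S \ coloops M G ⊆ gr M := Finset.sdiff_subset.trans (hSG.trans hGg)
  have hQ₁V : S.erase y₁ \ coloops M G = (S \ coloops M G).erase y₁ := by
    ext a; simp only [Finset.mem_sdiff, Finset.mem_erase]; tauto
  have hV5 : rkN M (S \ coloops M G) = 5 := by
    have ha : rkN M (S.erase y₁ \ coloops M G) ≤ rkN M (S \ coloops M G) :=
      rkN_mono (Finset.sdiff_subset_sdiff (Finset.erase_subset _ _) (Finset.Subset.refl _))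
    have hb : rkN M (S \ coloops M G) ≤ rkN M (G \ coloops M G) :=
      rkN_mono (Finset.sdiff_subset_sdiff hSG (Finset.Subset.refl _))
    rw [rkN_sdiff_coloops_eq_five hG hk] at hb
    omega
  -- the two other coloops `y₂, y₃`
  have hwC₁ : w ∈ coloops M (S.erase y₁ \ coloops M G) := by
    rw [hQ₁V]; exact mem_coloops_erase_of_mem_coloops hwc hy₁w.symm
  obtain ⟨y₂, y₃, h23, hpair⟩ := Finset.card_eq_two.1 (show ((coloops M (S.erase y₁ \ coloops M G)).erase w).card = 2 by
    rw [Finset.card_erase_of_mem hwC₁, hC₁3])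
  have hC₁ : coloops M (S.erase y₁ \ coloops M G) = {w, y₂, y₃} := by
    rw [← Finset.insert_erase hwC₁, hpair]
  have hQ₂V : S.erase y₂ \ coloops M G = (S \ coloops M G).erase y₂ := by
    ext a; simp only [Finset.mem_sdiff, Finset.mem_erase]; tauto
  have hQ₃V : S.erase y₃ \ coloops M G = (S \ coloops M G).erase y₃ := by
    ext a; simp only [Finset.mem_sdiff, Finset.mem_erase]; tauto
  have hy₂C : y₂ ∈ coloops M (S.erase y₁ \ coloops M G) := by rw [hC₁]; simp
  have hy₃C : y₃ ∈ coloops M (S.erase y₁ \ coloops M G) := by rw [hC₁]; simp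
  have hwy₂ : w ≠ y₂ := by
    have : y₂ ∈ (coloops M (S.erase y₁ \ coloops M G)).erase w := by rw [hpair]; simp
    exact fun h => (Finset.mem_erase.1 this).1 h.symm
  have hwy₃ : w ≠ y₃ := by
    have : y₃ ∈ (coloops M (S.erase y₁ \ coloops M G)).erase w := by rw [hpair]; simp
    exact fun h => (Finset.mem_erase.1 this).1 h.symm
  have hy₂Q : y₂ ∈ S.erase y₁ \ coloops M G := (mem_coloops.1 hy₂C).1
  have hy₃Q : y₃ ∈ S.erase y₁ \ coloops M G := (mem_coloops.1 hy₃C).1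
  have hy₂V : y₂ ∈ S \ coloops M G := by rw [hQ₁V] at hy₂Q; exact (Finset.erase_subset _ _) hy₂Q
  have hy₃V : y₃ ∈ S \ coloops M G := by rw [hQ₁V] at hy₃Q; exact (Finset.erase_subset _ _) hy₃Q
  have h12 : y₁ ≠ y₂ := by rw [hQ₁V] at hy₂Q; exact fun h => (Finset.mem_erase.1 hy₂Q).1 h.symm
  have h13 : y₁ ≠ y₃ := by rw [hQ₁V] at hy₃Q; exact fun h => (Finset.mem_erase.1 hy₃Q).1 h.symm
  have hc₂ : y₂ ∉ coloops M (S \ coloops M G) := by rw [hc, Finset.mem_singleton]; exact hwy₂.symm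
  have hc₃ : y₃ ∉ coloops M (S \ coloops M G) := by rw [hc, Finset.mem_singleton]; exact hwy₃.symm
  have hcol₂ : y₂ ∈ coloops M ((S \ coloops M G).erase y₁) := by rw [← hQ₁V]; exact hy₂C
  have hcol₃ : y₃ ∈ coloops M ((S \ coloops M G).erase y₁) := by rw [← hQ₁V]; exact hy₃C
  -- the sources are among `y₁, y₂, y₃`
  have hSrc : ∀ y ∈ S, (∃ w' ∈ S.erase y, faceLossP M 5 G (bigP M G) (S.erase y) w' ≠ 0) →
      y = y₁ ∨ y = y₂ ∨ y = y₃ := by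
    intro y hy hsy
    by_cases hyy : y = y₁
    · exact Or.inl hyy
    have hyC := hsrc y₁ hy₁S ⟨w₁, hw₁, h0₁⟩ y hy hyy hsy
    obtain ⟨w', hw', hw0⟩ := hsy
    rw [hC₁, Finset.mem_insert, Finset.mem_insert, Finset.mem_singleton] at hyC
    rcases hyC with h | h | h
    · exfalso
      exact hw0 (by rw [h]; exact faceLossP_eq_zero_of_mem_coloops hG hd hk hs hl hSG hwc (h ▸ hw'))
    · exact Or.inr (Or.inl h)
    · exact Or.inr (Or.inr h)
  -- reduce the sum to the three points
  have hy₂S : y₂ ∈ S := (Finset.mem_sdiff.1 hy₂V).1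
  have hy₃S : y₃ ∈ S := (Finset.mem_sdiff.1 hy₃V).1
  have hT : ({y₁, y₂, y₃} : Finset α) ⊆ S := by
    intro a ha
    rw [Finset.mem_insert, Finset.mem_insert, Finset.mem_singleton] at ha
    rcases ha with rfl | rfl | rfl
    · exact hy₁S
    · exact hy₂S
    · exact hy₃S
  have hsum : ∑ y ∈ S, gtLoadAt M 5 G (bigP M G) (S.erase y) y =
      ∑ y ∈ ({y₁, y₂, y₃} : Finset α), gtLoadAt M 5 G (bigP M G) (S.erase y) y := by
    symm
    apply Finset.sum_subset hT
    intro y hy hyT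
    apply gtLoadAt_eq_zero_of_faceLossP_eq_zero
    intro w' hw'
    by_contra hne
    apply hyT
    rw [Finset.mem_insert, Finset.mem_insert, Finset.mem_singleton]
    exact hSrc y hy ⟨w', hw', hne⟩
  rw [hsum, Finset.sum_insert, Finset.sum_insert, Finset.sum_singleton]
  rotate_left
  · rw [Finset.mem_singleton]; exact h23
  · rw [Finset.mem_insert, Finset.mem_singleton]; push Not; exact ⟨h12, h13⟩
  -- the symmetric triple: the coloops of the other erasures
  obtain ⟨hcol₁', hcol₃'⟩ := coloops_erase_of_triple hVg hV5 hy₁V hy₂V hy₃V h12 h13 h23 hc₂ hc₃ hcol₂ hcol₃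
  have hcol₁'' : y₁ ∈ coloops M ((S \ coloops M G).erase y₃) ∧ y₂ ∈ coloops M ((S \ coloops M G).erase y₃) := by
    have := coloops_erase_of_triple hVg hV5 hy₁V hy₃V hy₂V h13 h12 h23.symm hc₃ hc₂ hcol₃ hcol₂
    exact ⟨this.1, this.2⟩
  -- the faces as insertions into the base
  have hF₁ : (S.erase y₂).erase y₃ = insert y₁ (((S.erase y₁).erase y₂).erase y₃) := by
    ext a; simp only [Finset.mem_erase, Finset.mem_insert]
    constructor
    · rintro ⟨ha3, ha2, haS⟩
      by_cases ha1 : a = y₁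
      · exact Or.inl ha1
      · exact Or.inr ⟨ha3, ha2, ha1, haS⟩
    · rintro (rfl | ⟨ha3, ha2, -, haS⟩)
      · exact ⟨h13, h12, hy₁S⟩
      · exact ⟨ha3, ha2, haS⟩
  have hF₂ : (S.erase y₁).erase y₃ = insert y₂ (((S.erase y₁).erase y₂).erase y₃) := face_eq_insert_base' hy₂S h12 h23
  have hF₃ : (S.erase y₁).erase y₂ = insert y₃ (((S.erase y₁).erase y₂).erase y₃) := face_eq_insert_base hy₃S h13 h23
  -- the closure property and the counts
  have hP1 := closureProp_faces hG hk hSG hKS hV5 hy₁V hy₂V hy₃V h12 h13 h23 hy₁c hc₂ hc₃ hcol₂ hcol₃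
  have hmH := card_sdiff_clF_erase_coloop hG hk hSG hKS hwc
  -- `H` misses at least two points (the face of `S ∖ y₁` at `w` is a thin member with closure `H`)
  have hmH2 : 2 ≤ (G \ clF M (S.erase w)).card := by
    obtain ⟨hthinw, -, -⟩ := faces_thin_of_triple hG hd hk hs hl hw₁ h0₁ hC₁
    have := two_le_card_sdiff_of_not_lay0 hG hd' (mem_thinMembers.1 hthinw).1 (mem_thinMembers.1 hthinw).2
    rw [clF_face_coloop_eq hG hSG hV5 hwc hy₁V hy₁w hy₁c] at this
    exact this
  rw [card_not_H (H := fun x => x ∈ clF M (S.erase w)) hP1] at hmH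
  have hm₁ := card_sdiff_clF_face_pair hG hk hSG hKS hV5 hy₂V hy₃V h23 hc₂ hc₃ hcol₃' hcol₁''.2
  rw [hF₁, card_not_A₁ (H := fun x => x ∈ clF M (S.erase w)) hP1] at hm₁
  have hm₂ := card_sdiff_clF_face_pair hG hk hSG hKS hV5 hy₁V hy₃V h13 hy₁c hc₃ hcol₃ hcol₁''.1
  rw [hF₂, card_not_A₁ (H := fun x => x ∈ clF M (S.erase w)) hP1.swap12] at hm₂
  have hm₃ := card_sdiff_clF_face_pair hG hk hSG hKS hV5 hy₁V hy₂V h12 hy₁c hc₂ hcol₂ hcol₁'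
  rw [hF₃, card_not_A₁ (H := fun x => x ∈ clF M (S.erase w)) hP1.swap13] at hm₃
  -- abbreviations (as equations, to keep the terms short)
  obtain ⟨P, hP⟩ : ∃ P : Finset α, P = ((S.erase y₁).erase y₂).erase y₃ := ⟨_, rfl⟩
  rw [← hP] at hF₁ hF₂ hF₃ hP1 hmH hm₁ hm₂ hm₃
  -- the requests
  have hcond_def : ∀ r : ℚ, r = (if (S.erase w ∈ thinMembers M 5 G ∨ (S.erase y₁).erase w ∈ thinMembers M 5 G ∨
      (S.erase y₂).erase w ∈ thinMembers M 5 G ∨ (S.erase y₃).erase w ∈ thinMembers M 5 G) then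
      phiQ 5 / (((G \ clF M (S.erase w)).card : ℚ) + 2) else 0) → True := fun _ _ => trivial
  obtain ⟨rH, hrH⟩ : ∃ r : ℚ, r = (if (S.erase w ∈ thinMembers M 5 G ∨ (S.erase y₁).erase w ∈ thinMembers M 5 G ∨
      (S.erase y₂).erase w ∈ thinMembers M 5 G ∨ (S.erase y₃).erase w ∈ thinMembers M 5 G) then
      phiQ 5 / (((G \ clF M (S.erase w)).card : ℚ) + 2) else 0) := ⟨_, rfl⟩
  -- `rH` is admissible for `m_H = |G ∖ H|`
  have hHadm : AdmissibleReq (G \ clF M (S.erase w)).card rH := by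
    by_cases hcond : (S.erase w ∈ thinMembers M 5 G ∨ (S.erase y₁).erase w ∈ thinMembers M 5 G ∨
      (S.erase y₂).erase w ∈ thinMembers M 5 G ∨ (S.erase y₃).erase w ∈ thinMembers M 5 G)
    · rw [hrH, if_pos hcond]; exact admissible_of_eq_req (Or.inl rfl)
    · rw [hrH, if_neg hcond]; exact admissible_of_eq_req (Or.inr rfl)
  -- the faces with the closures `H′_a`: `r_a = faceReq (insert y_a P)`
  have h₁adm : AdmissibleReq (G \ clF M (insert y₁ P)).card (faceReq M G (insert y₁ P)) :=
    admissible_faceReq (by omega)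
  have h₂adm : AdmissibleReq (G \ clF M (insert y₂ P)).card (faceReq M G (insert y₂ P)) :=
    admissible_faceReq (by omega)
  have h₃adm : AdmissibleReq (G \ clF M (insert y₃ P)).card (faceReq M G (insert y₃ P)) :=
    admissible_faceReq (by omega)
  -- the fat rule: two requests `7/24` would give two distinct fat closures
  have hwP : w ∈ P := by
    rw [hP]
    exact Finset.mem_erase.2 ⟨hwy₃, Finset.mem_erase.2 ⟨hwy₂, Finset.mem_erase.2 ⟨hy₁w.symm, (Finset.mem_sdiff.1 (mem_coloops.1 hwc).1).1⟩⟩⟩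
  have hPG : P ⊆ G := by
    rw [hP]
    exact ((Finset.erase_subset _ _).trans ((Finset.erase_subset _ _).trans (Finset.erase_subset _ _))).trans hSG
  have hwH : w ∉ clF M (S.erase w) := coloop_notMem_clF_erase hG hk hSG hKS hwc
  have htwo : ∀ A B : Finset α, A ∈ fatClosures M 5 G 2 → B ∈ fatClosures M 5 G 2 → A ≠ B → False :=
    fun _ _ hA hB hAB => hAB (eq_of_mem_fatClosures_of_card_le_one hfat hA hB)
  have hHfat : rH = 7 / 24 → clF M (S.erase w) ∈ fatClosures M 5 G 2 := by
    intro hr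
    by_cases hcond : (S.erase w ∈ thinMembers M 5 G ∨ (S.erase y₁).erase w ∈ thinMembers M 5 G ∨
      (S.erase y₂).erase w ∈ thinMembers M 5 G ∨ (S.erase y₃).erase w ∈ thinMembers M 5 G)
    · rw [hrH, if_pos hcond] at hr
      have hm2 : (G \ clF M (S.erase w)).card = 2 := by
        by_contra hne
        have h3 : (3 : ℚ) ≤ ((G \ clF M (S.erase w)).card : ℚ) := by exact_mod_cast (by omega : 3 ≤ (G \ clF M (S.erase w)).card)
        unfold phiQ at hr
        rw [div_eq_iff (by linarith)] at hr
        linarith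
      -- a thin face with closure `H`
      have hface : ∀ y ∈ S \ coloops M G, y ≠ w → y ∉ coloops M (S \ coloops M G) →
          (S.erase y).erase w ∈ thinMembers M 5 G → clF M (S.erase w) ∈ fatClosures M 5 G 2 := by
        intro y hyV hyw hyc hthin
        unfold fatClosures
        rw [Finset.mem_image]
        refine ⟨(S.erase y).erase w, Finset.mem_filter.2 ⟨hthin, ?_⟩, clF_face_coloop_eq hG hSG hV5 hwc hyV hyw hyc⟩
        rw [clF_face_coloop_eq hG hSG hV5 hwc hyV hyw hyc, hm2]
      rcases hcond with h | h | h | h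
      · unfold fatClosures; rw [Finset.mem_image]; exact ⟨S.erase w, Finset.mem_filter.2 ⟨h, by rw [hm2]⟩, rfl⟩
      · exact hface y₁ hy₁V hy₁w hy₁c h
      · exact hface y₂ hy₂V hwy₂.symm hc₂ h
      · exact hface y₃ hy₃V hwy₃.symm hc₃ h
    · rw [hrH, if_neg hcond] at hr; norm_num at hr
  have hHne : ∀ y, y ∈ gr M → clF M (S.erase w) ≠ clF M (insert y P) := by
    intro y hy h
    apply hwH
    rw [h]
    exact subset_clF_of_subset_gr (Finset.insert_subset hy (hPG.trans hGg)) (Finset.mem_insert_of_mem hwP)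
  -- the requests of the faces at `w` equal `rH` (for thin faces)
  have hreqw : ∀ y ∈ S \ coloops M G, y ≠ w → y ∉ coloops M (S \ coloops M G) →
      (y = y₁ ∨ y = y₂ ∨ y = y₃) → (S.erase y).erase w ∈ thinMembers M 5 G → req M 5 ((S.erase y).erase w) = rH := by
    intro y hyV hyw hyc hy3 hthin
    have hcond : (S.erase w ∈ thinMembers M 5 G ∨ (S.erase y₁).erase w ∈ thinMembers M 5 G ∨
        (S.erase y₂).erase w ∈ thinMembers M 5 G ∨ (S.erase y₃).erase w ∈ thinMembers M 5 G) := by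
      rcases hy3 with rfl | rfl | rfl
      · exact Or.inr (Or.inl hthin)
      · exact Or.inr (Or.inr (Or.inl hthin))
      · exact Or.inr (Or.inr (Or.inr hthin))
    rw [hrH, if_pos hcond, req_eq_of_thin hG hthin, hd, clF_face_coloop_eq hG hSG hV5 hwc hyV hyw hyc]
    push_cast; ring
  -- `L1 S ≤ rH`: the only possible thin face of `S` is the face at `w`
  have hL1rH : L1 M 5 G S ≤ rH := by
    unfold L1
    have hsub := thin_coverPreimages_subset_image_coloops hG hd' S
    rw [hc, Finset.image_singleton] at hsub
    by_cases hthinS : S.erase w ∈ thinMembers M 5 G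
    · have hcond : (S.erase w ∈ thinMembers M 5 G ∨ (S.erase y₁).erase w ∈ thinMembers M 5 G ∨
          (S.erase y₂).erase w ∈ thinMembers M 5 G ∨ (S.erase y₃).erase w ∈ thinMembers M 5 G) := Or.inl hthinS
      have hle : ∑ F ∈ (coverPreimages M (Uq M (5 + 2) 5) G S).filter (fun F => F ∉ lay0 M 5 G), req M 5 F ≤
          ∑ F ∈ ({S.erase w} : Finset (Finset α)), req M 5 F := by
        apply Finset.sum_le_sum_of_subset_of_nonneg hsub
        intro F _ _
        exact req_nonneg 5 F
      rw [Finset.sum_singleton, req_eq_of_thin hG hthinS, hd] at hle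
      rw [hrH, if_pos hcond]
      push_cast at hle ⊢
      linarith
    · -- no thin face: the filter is empty
      have hempty : (coverPreimages M (Uq M (5 + 2) 5) G S).filter (fun F => F ∉ lay0 M 5 G) = ∅ := by
        rw [Finset.eq_empty_iff_forall_notMem]
        intro F hF
        have hF' := hsub hF
        rw [Finset.mem_singleton] at hF'
        rw [Finset.mem_filter, mem_coverPreimages] at hF
        exact hthinS (hF' ▸ mem_thinMembers.2 ⟨hF.1.1, hF.2⟩)
      rw [hempty, Finset.sum_empty]
      exact hHadm.nonneg
  -- the nine type counts
  obtain ⟨n₀, hn₀⟩ : ∃ n, n = typeCount (G \ S) (fun x => x ∈ clF M (S.erase w)) (fun x => x ∈ clF M (insert y₁ P)) (fun x => x ∈ clF M (insert y₂ P)) (fun x => x ∈ clF M (insert y₃ P)) true false false false := ⟨_, rfl⟩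
  obtain ⟨n₁, hn₁⟩ : ∃ n, n = typeCount (G \ S) (fun x => x ∈ clF M (S.erase w)) (fun x => x ∈ clF M (insert y₁ P)) (fun x => x ∈ clF M (insert y₂ P)) (fun x => x ∈ clF M (insert y₃ P)) true true false false := ⟨_, rfl⟩
  obtain ⟨n₂, hn₂⟩ : ∃ n, n = typeCount (G \ S) (fun x => x ∈ clF M (S.erase w)) (fun x => x ∈ clF M (insert y₁ P)) (fun x => x ∈ clF M (insert y₂ P)) (fun x => x ∈ clF M (insert y₃ P)) true false true false := ⟨_, rfl⟩
  obtain ⟨n₃, hn₃⟩ : ∃ n, n = typeCount (G \ S) (fun x => x ∈ clF M (S.erase w)) (fun x => x ∈ clF M (insert y₁ P)) (fun x => x ∈ clF M (insert y₂ P)) (fun x => x ∈ clF M (insert y₃ P)) true false false true := ⟨_, rfl⟩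
  obtain ⟨z₀, hz₀⟩ : ∃ n, n = typeCount (G \ S) (fun x => x ∈ clF M (S.erase w)) (fun x => x ∈ clF M (insert y₁ P)) (fun x => x ∈ clF M (insert y₂ P)) (fun x => x ∈ clF M (insert y₃ P)) false false false false := ⟨_, rfl⟩
  obtain ⟨z₁, hz₁⟩ : ∃ n, n = typeCount (G \ S) (fun x => x ∈ clF M (S.erase w)) (fun x => x ∈ clF M (insert y₁ P)) (fun x => x ∈ clF M (insert y₂ P)) (fun x => x ∈ clF M (insert y₃ P)) false true false false := ⟨_, rfl⟩
  obtain ⟨z₂, hz₂⟩ : ∃ n, n = typeCount (G \ S) (fun x => x ∈ clF M (S.erase w)) (fun x => x ∈ clF M (insert y₁ P)) (fun x => x ∈ clF M (insert y₂ P)) (fun x => x ∈ clF M (insert y₃ P)) false false true false := ⟨_, rfl⟩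
  obtain ⟨z₃, hz₃⟩ : ∃ n, n = typeCount (G \ S) (fun x => x ∈ clF M (S.erase w)) (fun x => x ∈ clF M (insert y₁ P)) (fun x => x ∈ clF M (insert y₂ P)) (fun x => x ∈ clF M (insert y₃ P)) false false false true := ⟨_, rfl⟩
  obtain ⟨zA, hzA⟩ : ∃ n, n = typeCount (G \ S) (fun x => x ∈ clF M (S.erase w)) (fun x => x ∈ clF M (insert y₁ P)) (fun x => x ∈ clF M (insert y₂ P)) (fun x => x ∈ clF M (insert y₃ P)) false true true true := ⟨_, rfl⟩
  simp only [typeCount_swap12 (A₁ := fun x => x ∈ clF M (insert y₁ P)) (A₂ := fun x => x ∈ clF M (insert y₂ P))] at hm₂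
  simp only [typeCount_swap13 (A₁ := fun x => x ∈ clF M (insert y₁ P)) (A₃ := fun x => x ∈ clF M (insert y₃ P))] at hm₃
  simp only [← hn₀, ← hn₁, ← hn₂, ← hn₃, ← hz₀, ← hz₁, ← hz₂, ← hz₃, ← hzA] at hmH hm₁ hm₂ hm₃
  -- the requests `r_a`
  obtain ⟨r₁, hr₁⟩ : ∃ r, r = faceReq M G (insert y₁ P) := ⟨_, rfl⟩
  obtain ⟨r₂, hr₂⟩ : ∃ r, r = faceReq M G (insert y₂ P) := ⟨_, rfl⟩
  obtain ⟨r₃, hr₃⟩ : ∃ r, r = faceReq M G (insert y₃ P) := ⟨_, rfl⟩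
  rw [← hr₁] at h₁adm; rw [← hr₂] at h₂adm; rw [← hr₃] at h₃adm
  -- the face at `w` of each erasure, and the faces `(S ∖ y_a) ∖ y_b` as insertions
  have hF₁₂ : (S.erase y₁).erase y₂ = insert y₃ P := hF₃
  have hF₁₃ : (S.erase y₁).erase y₃ = insert y₂ P := hF₂
  have hF₂₃ : (S.erase y₂).erase y₃ = insert y₁ P := hF₁
  have hF₂₁ : (S.erase y₂).erase y₁ = insert y₃ P := by rw [Finset.erase_right_comm]; exact hF₃
  have hF₃₁ : (S.erase y₃).erase y₁ = insert y₂ P := by rw [Finset.erase_right_comm]; exact hF₂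
  have hF₃₂ : (S.erase y₃).erase y₂ = insert y₁ P := by rw [Finset.erase_right_comm]; exact hF₁
  -- THE BOUND FOR THE SOURCE `y₁`
  have hb₁ : gtLoadAt M 5 G (bigP M G) (S.erase y₁) y₁ ≤
      max (rH + r₂ + r₃ - 11 / 18) 0 / ((1 + n₁ + n₀ + (z₀ + z₁ + z₂ + z₃) : ℕ) : ℚ) := by
    have hg := card_gtPts_ge_outside hG hd hk hs hl hSG hc hy₁S hw₁ h0₁ hC₁ hwy₂ hwy₃ h23
    rw [hF₁₃, hF₁₂, card_good₁ hP1] at hg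
    simp only [← hn₀, ← hn₁, ← hz₀, ← hz₁, ← hz₂, ← hz₃] at hg
    exact gtLoadAt_le_of_triple hG hd hk hs hl hSG hc hy₁S hw₁ h0₁ hC₁ hwy₂ hwy₃ h23 hF₁₂ hF₁₃
      (hreqw y₁ hy₁V hy₁w hy₁c (Or.inl rfl)) hr₂ hr₃ (by omega) (by omega)
  -- THE BOUND FOR `y₂` (a source or not)
  have hb₂ : gtLoadAt M 5 G (bigP M G) (S.erase y₂) y₂ ≤
      max (rH + r₁ + r₃ - 11 / 18) 0 / ((1 + n₂ + n₀ + (z₀ + z₁ + z₂ + z₃) : ℕ) : ℚ) := by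
    by_cases hsrc₂ : ∃ w' ∈ S.erase y₂, faceLossP M 5 G (bigP M G) (S.erase y₂) w' ≠ 0
    swap
    · push Not at hsrc₂
      rw [gtLoadAt_eq_zero_of_faceLossP_eq_zero _ (fun w' hw' => hsrc₂ w' hw') y₂]
      positivity
    obtain ⟨w₂, hw₂, h0₂⟩ := hsrc₂
    have hC₂ : coloops M (S.erase y₂ \ coloops M G) = {w, y₁, y₃} :=
      coloops_eq_triple (lossy_structure_of_faceLossP_ne_zero hG hd hk hs hl hw₂ h0₂).2.2.1
        (by rw [hQ₂V]; exact mem_coloops_erase_of_mem_coloops hwc hwy₂) (by rw [hQ₂V]; exact hcol₁')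
        (by rw [hQ₂V]; exact hcol₃') hy₁w.symm hwy₃ h13
    have hg := card_gtPts_ge_outside hG hd hk hs hl hSG hc hy₂S hw₂ h0₂ hC₂ hy₁w.symm hwy₃ h13
    rw [hF₂₃, hF₂₁, card_good₁ hP1.swap12] at hg
    simp only [typeCount_swap12 (A₁ := fun x => x ∈ clF M (insert y₁ P)) (A₂ := fun x => x ∈ clF M (insert y₂ P))] at hg
    simp only [← hn₀, ← hn₂, ← hz₀, ← hz₁, ← hz₂, ← hz₃] at hg
    exact gtLoadAt_le_of_triple hG hd hk hs hl hSG hc hy₂S hw₂ h0₂ hC₂ hy₁w.symm hwy₃ h13 hF₂₁ hF₂₃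
      (hreqw y₂ hy₂V hwy₂.symm hc₂ (Or.inr (Or.inl rfl))) hr₁ hr₃ (by omega) (by omega)
  -- THE BOUND FOR `y₃`
  have hb₃ : gtLoadAt M 5 G (bigP M G) (S.erase y₃) y₃ ≤
      max (rH + r₁ + r₂ - 11 / 18) 0 / ((1 + n₃ + n₀ + (z₀ + z₁ + z₂ + z₃) : ℕ) : ℚ) := by
    by_cases hsrc₃ : ∃ w' ∈ S.erase y₃, faceLossP M 5 G (bigP M G) (S.erase y₃) w' ≠ 0
    swap
    · push Not at hsrc₃
      rw [gtLoadAt_eq_zero_of_faceLossP_eq_zero _ (fun w' hw' => hsrc₃ w' hw') y₃]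
      positivity
    obtain ⟨w₃, hw₃, h0₃⟩ := hsrc₃
    have hC₃ : coloops M (S.erase y₃ \ coloops M G) = {w, y₁, y₂} :=
      coloops_eq_triple (lossy_structure_of_faceLossP_ne_zero hG hd hk hs hl hw₃ h0₃).2.2.1
        (by rw [hQ₃V]; exact mem_coloops_erase_of_mem_coloops hwc hwy₃) (by rw [hQ₃V]; exact hcol₁''.1)
        (by rw [hQ₃V]; exact hcol₁''.2) hy₁w.symm hwy₂ h12
    have hg := card_gtPts_ge_outside hG hd hk hs hl hSG hc hy₃S hw₃ h0₃ hC₃ hy₁w.symm hwy₂ h12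
    rw [hF₃₂, hF₃₁, card_good₁ hP1.swap12.swap13] at hg
    simp only [typeCount_swap13 (A₁ := fun x => x ∈ clF M (insert y₂ P)) (A₂ := fun x => x ∈ clF M (insert y₁ P))
      (A₃ := fun x => x ∈ clF M (insert y₃ P)),
      typeCount_swap12 (A₁ := fun x => x ∈ clF M (insert y₁ P)) (A₂ := fun x => x ∈ clF M (insert y₂ P))] at hg
    simp only [← hn₀, ← hn₃, ← hz₀, ← hz₁, ← hz₂, ← hz₃] at hg
    exact gtLoadAt_le_of_triple hG hd hk hs hl hSG hc hy₃S hw₃ h0₃ hC₃ hy₁w.symm hwy₂ h12 hF₃₁ hF₃₂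
      (hreqw y₃ hy₃V hwy₃.symm hc₃ (Or.inr (Or.inr rfl))) hr₁ hr₂ (by omega) (by omega)
  -- THE FAT RULE: at most one of the four requests equals `7/24`
  have hmemcl : ∀ y ∈ S \ coloops M G, y ∈ clF M (insert y P) := fun y hy =>
    subset_clF_of_subset_gr (Finset.insert_subset (hVg hy) (hPG.trans hGg)) (Finset.mem_insert_self _ _)
  have hne₁₂ : clF M (insert y₁ P) ≠ clF M (insert y₂ P) := by
    intro h
    have h1 := notMem_clF_face_pair hG hk hSG hKS hV5 hy₁V hy₃V hy₁c hc₃ hcol₃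
    rw [hF₁₃, ← h] at h1
    exact h1 (hmemcl y₁ hy₁V)
  have hne₁₃ : clF M (insert y₁ P) ≠ clF M (insert y₃ P) := by
    intro h
    have h1 := notMem_clF_face_pair hG hk hSG hKS hV5 hy₁V hy₂V hy₁c hc₂ hcol₂
    rw [hF₁₂, ← h] at h1
    exact h1 (hmemcl y₁ hy₁V)
  have hne₂₃ : clF M (insert y₂ P) ≠ clF M (insert y₃ P) := by
    intro h
    have h1 := notMem_clF_face_pair hG hk hSG hKS hV5 hy₂V hy₁V hc₂ hy₁c hcol₁'
    rw [hF₂₁, ← h] at h1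
    exact h1 (hmemcl y₂ hy₂V)
  have hfat₁ : r₁ = 7 / 24 → clF M (insert y₁ P) ∈ fatClosures M 5 G 2 := fun h =>
    (clF_mem_fatClosures_of_faceReq_eq (by omega) (by rw [← hr₁]; exact h)).2
  have hfat₂ : r₂ = 7 / 24 → clF M (insert y₂ P) ∈ fatClosures M 5 G 2 := fun h =>
    (clF_mem_fatClosures_of_faceReq_eq (by omega) (by rw [← hr₂]; exact h)).2
  have hfat₃ : r₃ = 7 / 24 → clF M (insert y₃ P) ∈ fatClosures M 5 G 2 := fun h =>
    (clF_mem_fatClosures_of_faceReq_eq (by omega) (by rw [← hr₃]; exact h)).2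
  have hfatrule : (rH = 7 / 24 → r₁ ≠ 7 / 24 ∧ r₂ ≠ 7 / 24 ∧ r₃ ≠ 7 / 24) ∧
      (r₁ = 7 / 24 → r₂ ≠ 7 / 24 ∧ r₃ ≠ 7 / 24) ∧ (r₂ = 7 / 24 → r₃ ≠ 7 / 24) :=
    ⟨fun h => ⟨fun h₁ => htwo _ _ (hHfat h) (hfat₁ h₁) (hHne y₁ (hVg hy₁V)),
        fun h₂ => htwo _ _ (hHfat h) (hfat₂ h₂) (hHne y₂ (hVg hy₂V)),
        fun h₃ => htwo _ _ (hHfat h) (hfat₃ h₃) (hHne y₃ (hVg hy₃V))⟩,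
      fun h₁ => ⟨fun h₂ => htwo _ _ (hfat₁ h₁) (hfat₂ h₂) hne₁₂, fun h₃ => htwo _ _ (hfat₁ h₁) (hfat₃ h₃) hne₁₃⟩,
      fun h₂ h₃ => htwo _ _ (hfat₂ h₂) (hfat₃ h₃) hne₂₃⟩
  -- THE FINITE CHECK AND THE CONCLUSION
  have hZ : 1 ≤ z₀ + z₁ + z₂ + z₃ + zA := by omega
  have hfin := caseOne_finite_check (n₀ := n₀) (n₁ := n₁) (n₂ := n₂) (n₃ := n₃) (z₀ := z₀) (z₁ := z₁) (z₂ := z₂)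
    (z₃ := z₃) (zA := zA) (m₁ := (G \ clF M (insert y₁ P)).card) (m₂ := (G \ clF M (insert y₂ P)).card)
    (m₃ := (G \ clF M (insert y₃ P)).card) (g₁ := 1 + n₁ + n₀ + (z₀ + z₁ + z₂ + z₃))
    (g₂ := 1 + n₂ + n₀ + (z₀ + z₁ + z₂ + z₃)) (g₃ := 1 + n₃ + n₀ + (z₀ + z₁ + z₂ + z₃)) (rH := rH) (r₁ := r₁)
    (r₂ := r₂) (r₃ := r₃) hmH hZ (by omega) (by omega) (by omega) rfl rfl rfl hHadm h₁adm h₂adm h₃adm hfatrule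
  linarith [hb₁, hb₂, hb₃, hfin, hcap2, hcapS, hL1rH]

end MainB

end PercRepro.Shadow
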